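import Literature.MathematicalPhysics.QuantumFieldTheory.Balaban1983to89.HiggsCondCov232

/-!
# `Balaban1983to89.B1Ineq233Upper` — T. Bałaban, *(Higgs)₂,₃ quantum fields in a finite volume. I. A lower bound*,
Commun. Math. Phys. **85** (1982) 603–626 [Balaban1982Higgs1], Proposition 2.3 p. 611: the UPPER HALF of (2.33)
`aL^{−2}P(A) + Δ^{(k)}(Ω, A) ≦ γ₁I` for the CONCRETE operators of the (Higgs)₂,₃ model (p35's
`B1Eq230FluctCov.precOpA`, an ARBITRARY external vector field `A`, region `Ω ⊂ T_ε`, coupling `U(A) = exp(qεeA)`),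
with an EXPLICIT constant `γ₁` uniform in `k`, `ε`, `Ω`, `Λ` and `A` — and the equivalent statements
`C^{(k)}(Ω, A) ≧ γ₁^{−1}I`, `C^{(k)}_Λ(Ω, A) ≧ γ₁^{−1}I↾_Λ` for the covariances (2.30)/(2.32); theorems only

statement-level skeleton of published theorems with citation tags; proofs where landed; nothing here is a claim about the Yang–Mills mass gap

PDF held: `paper:balaban1982-cmp85-higgs23-i` (journal page = PDF page + 602); pp. 604–605, 608–612 [PDF 2–3, 6–10]
read AS IMAGES on the ×4 renders `run/shared/lean/pub/pub-balaban/b2b-balaban-ref1/pages/1982-cmp85-higgs23-I/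
1982-cmp85-higgs23-I-p009-x4.png` (Prop. 2.3) and `…-p008-x4.png` ((2.17)–(2.21)).

CITATION HEADER (lean-in-tree rule) — WHAT IS REPRODUCED.  Cell `lit-balaban` (HOME `run/shared/lean/pub/lit-balaban/`),
unit `lit-balaban-r14` gen 6 (literature-prover-lit-balaban-r14-g6-0; B1 fold owner), own-lineage free target
(PHASE2-TARGETS §G.5-34(d); TAKING line HOME/STATUS.md 2026-08-21T06:59:16Z).  SKELETON rows served: **B1.Prop2.3**
(member (2.33), its UPPER inequality, at the print's generality *"independent of A, k, Ω and Λ"* — indeed for EVERY `A`,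
regular or not) and **B1.Eq2.30** ((2.30)/(2.32): the lower bounds on the covariances that the upper inequality is
equivalent to).  NO decl of record is restated: the operators are p35's `B1Eq230FluctCov.deltaKA` / `blockProjA` /
`precOpA` / `fluctCovA`, the one-step `Q(A)`, `Q^*(A)` are p35's `B1Eq27StepAdjoint.avgQLin` / `avgQAdjLin`, the
conditional covariance (2.32) is the typer's `HiggsCondCov232.condCov232`, the symmetry / positivity / *"It is so"*
statements are the typer's `B1Eq230FluctCovPos` — all consumed BY NAME.  The typer's scope note there (*"the uniform
constants γ₀, γ₁ of (2.33) are NOT touched"*) is what this file answers for `γ₁`.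
THE SOURCE TEXT, verbatim (p. 611 [PDF 9]).  *"Proposition 2.3. If a configuration A is regular on Ω in the sense
defined in Proposition 2.1, then there exist positive constants δ₀, c₀, γ₀, γ₁, dependent on d and a, and independent
of A, k, Ω and Λ, such that γ₀I ≦ aL^{−2}P(A) + Δ^{(k)}(Ω, A) ≦ γ₁I, (2.33)"*; *"C^{(k),L^kε}(Ω, A) = (a(L^{k+1}ε)^{−2}P(A)
+ Δ^{(k),L^kε}(Ω, A))^{−1}. (2.30) In the sequel we will use the covariance rescaled to the unit lattice and it is of
the form C^{(k)}(Ω, A) = (aL^{−2}P(A) + Δ^{(k)}(Ω, A))^{−1}. (2.31) … C^{(k)}_Λ(Ω, A) = ((aL^{−2}P(A) + Δ^{(k)}(Ω, A))↾_Λ)^{−1}.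
(2.32)"*; p. 610 [PDF 8]: *"⟨ψ, Δ^{(k),L^kε}(Ω, A)ψ⟩ = a_k(L^kε)^{−2}⟨ψ,ψ⟩ − a_k²(L^kε)^{−4}⟨ψ, Q_k(A)G^ε_k(Ω, A)Q^*_k(A)ψ⟩.
(2.21)"*; p. 609 [PDF 7]: *"a_k = a(1 − L^{−2})/(1 − L^{−2k}) (2.15)"*; p. 605 [PDF 3]: *"Antisymmetry of q implies
U(A)^* = U(−A) = U(−A)^{−1}"*.
THE ARGUMENT (standard, three lines; the paper defers all of Prop. 2.3 to [B4]).  `P(A) = Q^*(A)Q(A)` with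
`Q(A)Q^*(A) = 1` (`B1Eq27StepAdjoint.avgQLin_avgQAdjLin`, blocks of `L^d` points, unitary transports) and `Q^*(A)` the
(1.5)-adjoint ⇒ `⟨f, P(A)f⟩ = |f|² − |f − P(A)f|² ≤ |f|²`; `G^ε_k(Ω, A) ≥ 0` (inverse of the positive operator (2.20),
`HiggsCovariancePos.siteInner_propagatorK_nonneg`) ⇒ by (2.21) `⟨ψ, Δ^{(k)}ψ⟩ ≤ a_k(L^kε)^{−2}|ψ|²`; and for `k = 0`,
`Δ^{(0)} = −Δ^{ε,N}_{A,Ω} + m²` with the elementary lattice bound `⟨φ, −Δ^{η,N}_{A,Ω}φ⟩ ≤ 4dη^{−2}|φ|²` (each bond term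
`|U(A_b)φ(b₊) − φ(b₋)|² ≤ 2|φ(b₊)|² + 2|φ(b₋)|²`, `|U v| = |v|`, every site meets `2d` bonds).  Hence, on the unit
lattice of (2.31) (`P.unitAt k`), `aL^{−2}P(A) + Δ^{(k)}(Ω, A) ≤ (aL^{−2} + a_k)I ≤ a(1 + L^{−2})I` for `1 ≤ k < K`
(`B1.aSeq_le`: `a_k ≤ a`), i.e. **(2.33)-upper with `γ₁ = a(1 + L^{−2})`**, depending on `a` (and the fixed block
size `L`) only — uniform in `k`, `ε`, `Ω`, `A`; and the covariance bounds follow from the discriminant inequality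
`0 ≤ ⟨h − γ₁^{−1}g, M(h − γ₁^{−1}g)⟩`, `h = M^{−1}g` (no spectral theorem).

WHAT THIS FILE PROVES (0 sorry; axioms ⊆ {propext, Classical.choice, Quot.sound}; theorems only, no new `def`).
§1 `siteInner_inv_ge_of_form_le` — for a (1.5)-symmetric `M ≥ 0` with `M ≤ βI` and `M(M′g) = g`: `β^{−1}|g|² ≤ ⟨g, M′g⟩`.
§2 `siteInner_blockProjA_le` — `⟨f, P(A)f⟩ ≤ ⟨f, f⟩` (`k < K`), every `A`; `siteInner_blockProjA_eq_sub`.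
§3 `siteInner_QGQ_nonneg`, `siteInner_deltaKA_succ_le` — `⟨ψ, Δ^{(k),L^kε}(Ω,A)ψ⟩ ≤ a_k(L^kε)^{−2}⟨ψ,ψ⟩`, `k ≥ 1`, m² > 0.
§4 `siteInner_covLaplacianN_le` — `⟨φ, −Δ^{η,N}_{A,Ω}φ⟩ ≤ 4dη^{−2}⟨φ,φ⟩` (every level, `A`, `Ω`); `siteInner_deltaKA_zero_le`.
§5 the operator of (2.30): `siteInner_precOpA_succ_le` (`k ≥ 1`: bound `(a(L^{k+1}ε)^{−2} + a_k(L^kε)^{−2})|f|²`),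
   `siteInner_precOpA_succ_le_uniform` (`≤ (aL^{−2} + a)(L^kε)^{−2}|f|²`), `siteInner_precOpA_zero_le` (`k = 0`: bound
   `(a(Lε)^{−2} + 4dε^{−2} + m²)|f|²`); on the unit lattice `P.unitAt k`: **`ineq233_upper_unitAt`** (`≤ (aL^{−2} + a_k)|f|²`)
   and **`ineq233_upper_uniform`** (`≤ a(1 + L^{−2})|f|²`, one `γ₁` for all `1 ≤ k < K`, `Ω`, `A`, `ε`).
§6 covariances: `siteInner_fluctCovA_ge_succ` / `fluctCovA_ge_uniform_unitAt` (`⟨g, C^{(k)}(Ω,A)g⟩ ≥ γ₁^{−1}|g|²`) and the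
   conditioned (2.32) `siteInner_restrictOp_precOpA_le` / `siteInner_condCov232_ge` (`⟨g, C^{(k)}_Λ(Ω,A)g⟩ ≥ γ₁^{−1}|Λg|²`).
HONEST SCOPE.  Only the UPPER inequality of (2.33) (and its covariance duals) — the LOWER one `γ₀I ≦ …`, which needs
the regularity of `A` and is the content of [B4] Prop. 2.3 / Sect. 5, is NOT claimed here (the typer's
`siteInner_precOpA_pos` is its qualitative, non-uniform shadow).  Levels: the `P(A)`-part needs `k < K` (the one-step
`Q(A)` maps `T^{(k)} → T^{(k+1)}`, meaningful for `k + 1 ≤ K` — exactly the paper's range of fluctuation covariances);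
the covariance statements need m² > 0 (as in all concrete files: the operators act on fields on all of `T^{(k)}`).  The
`k = 0` constant carries `m²ε²` after rescaling (the paper's m² is fixed).  Value = kernel certificates for the concrete
objects at the print's generality in `A`; NOT summit progress.  Unit `lit-balaban-r14` gen 6; HOME/FILED.md records
the proposal.
-/

open scoped BigOperators InnerProductSpace

namespace Literature.MathematicalPhysics.QuantumFieldTheory.Balaban1983to89.B1Ineq233Upper

open HiggsLattice HiggsAveraging HiggsAveragingCompose HiggsCovariance HiggsCovariancePos HiggsCovarianceCont
  HiggsFluctMeasure HiggsFluctMeasurePos B1Eq27StepAdjoint B1Eq230FluctCov B1Eq230FluctCovPos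
  B2Eq255Concrete HiggsCondCov232

variable {P : HiggsLattice.Params} {N : ℕ}

/-! ## §1 The discriminant lemma: `M = M^* ≥ 0`, `M ≤ βI`, `MM′ = 1` ⇒ `M′ ≥ β^{−1}I` -/

section Discriminant

variable {j : ℕ}

/-- **Upper bound on a positive operator ⇒ lower bound on its inverse**, for the scalar product (1.5): if `M` is
symmetric, `⟨f, Mf⟩ ≥ 0`, `⟨f, Mf⟩ ≤ β⟨f, f⟩` for all `f` (`β > 0`) and `M(M′g) = g`, then `β^{−1}⟨g, g⟩ ≤ ⟨g, M′g⟩`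
(expand `0 ≤ ⟨h − β^{−1}g, M(h − β^{−1}g)⟩` with `h = M′g`; no spectral theorem). [cite: Balaban1982Higgs1, (2.33) p.611] -/
theorem siteInner_inv_ge_of_form_le (M M' : Module.End ℝ (ScalarField P j N))
    (hsymm : ∀ f g : ScalarField P j N, siteInner f (M g) = siteInner g (M f))
    (hnonneg : ∀ f : ScalarField P j N, 0 ≤ siteInner f (M f)) {β : ℝ} (hβ : 0 < β)
    (hle : ∀ f : ScalarField P j N, siteInner f (M f) ≤ β * siteInner f f)
    (g : ScalarField P j N) (hinv : M (M' g) = g) :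
    β⁻¹ * siteInner g g ≤ siteInner g (M' g) := by
  have hβi : 0 ≤ β⁻¹ := inv_nonneg.mpr hβ.le
  have e1 : siteInner (M' g - β⁻¹ • g) (M (M' g - β⁻¹ • g))
      = siteInner (M' g - β⁻¹ • g) g - β⁻¹ * siteInner (M' g - β⁻¹ • g) (M g) := by
    rw [map_sub, map_smul, hinv, siteInner_sub_right, siteInner_smul_right]
  have e2 : siteInner (M' g - β⁻¹ • g) g = siteInner g (M' g) - β⁻¹ * siteInner g g := by
    rw [siteInner_comm, siteInner_sub_right, siteInner_smul_right]
  have e3 : siteInner (M' g - β⁻¹ • g) (M g) = siteInner g g - β⁻¹ * siteInner g (M g) := by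
    rw [siteInner_comm, siteInner_sub_right, siteInner_smul_right, siteInner_comm (M g) (M' g), hsymm (M' g) g, hinv,
      siteInner_comm (M g) g]
  have h0 := hnonneg (M' g - β⁻¹ • g)
  rw [e1, e2, e3] at h0
  have h1 : β⁻¹ * siteInner g (M g) ≤ siteInner g g := by
    calc β⁻¹ * siteInner g (M g) ≤ β⁻¹ * (β * siteInner g g) := mul_le_mul_of_nonneg_left (hle g) hβi
      _ = siteInner g g := by rw [← mul_assoc, inv_mul_cancel₀ hβ.ne', one_mul]
  have h2 : β⁻¹ * (β⁻¹ * siteInner g (M g)) ≤ β⁻¹ * siteInner g g := mul_le_mul_of_nonneg_left h1 hβi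
  nlinarith [h0, h2]

end Discriminant

/-! ## §2 `P(A) = Q^*(A)Q(A) ≤ 1`: `⟨f, P(A)f⟩ ≤ ⟨f, f⟩` (every `A`, `k < K`) -/

section Projection

variable (C : ChargeData N) (A : HiggsLattice.VecField P 0)

/-- `|P(A)f|² = ⟨f, P(A)f⟩`: `⟨Q^*Qf, Q^*Qf⟩ = ⟨QQ^*Qf, Qf⟩ = ⟨Qf, Qf⟩` (`QQ^* = 1`, `k < K`; adjointness (1.5)).
[cite: Balaban1982Higgs1, (2.30) p.611] -/
theorem siteInner_blockProjA_self {j : ℕ} (hj : j < P.K) (f : ScalarField P j N) :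
    siteInner (blockProjA C A j f) (blockProjA C A j f) = siteInner f (blockProjA C A j f) := by
  rw [siteInner_blockProjA_eq C A j f f]
  show siteInner (avgQAdjLin C A j (avgQLin C A j f)) (avgQAdjLin C A j (avgQLin C A j f)) = _
  rw [← siteInner_avgQLin, avgQLin_avgQAdjLin hj]

/-- `⟨f, P(A)f⟩ = ⟨f, f⟩ − |f − P(A)f|²` (`k < K`): `P(A)` is a (1.5)-orthogonal projection. [cite: Balaban1982Higgs1, (2.30) p.611] -/
theorem siteInner_blockProjA_eq_sub {j : ℕ} (hj : j < P.K) (f : ScalarField P j N) :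
    siteInner f (blockProjA C A j f)
      = siteInner f f - siteInner (f - blockProjA C A j f) (f - blockProjA C A j f) := by
  have hpp := siteInner_blockProjA_self C A hj f
  rw [siteInner_sub_right, siteInner_comm (f - blockProjA C A j f) f,
    siteInner_comm (f - blockProjA C A j f) (blockProjA C A j f), siteInner_sub_right, siteInner_sub_right, hpp,
    siteInner_comm (blockProjA C A j f) f]
  ring

/-- **`P(A) ≤ 1`**: `⟨f, P(A)f⟩ ≤ ⟨f, f⟩` for EVERY external field `A`, every coupling, `k < K` — the `P(A)`-part of
the upper inequality of (2.33). PROVED. [cite: Balaban1982Higgs1, (2.33) p.611] -/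
theorem siteInner_blockProjA_le {j : ℕ} (hj : j < P.K) (f : ScalarField P j N) :
    siteInner f (blockProjA C A j f) ≤ siteInner f f := by
  rw [siteInner_blockProjA_eq_sub C A hj f]
  linarith [siteInner_self_nonneg (f - blockProjA C A j f)]

/-- `|Q(A)f|² ≤ |f|²` (norms (1.5) of `T^{(k+1)}` and `T^{(k)}`): the one-step covariant average does not increase the
(1.5)-norm, every `A`, `k < K`. [cite: Balaban1982Higgs1, (2.7) p.608] -/
theorem siteInner_avgQLin_self_le {j : ℕ} (hj : j < P.K) (f : ScalarField P j N) :
    siteInner (avgQLin C A j f) (avgQLin C A j f) ≤ siteInner f f := by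
  rw [← siteInner_blockProjA_eq C A j f f]
  exact siteInner_blockProjA_le C A hj f

end Projection

/-! ## §3 `Δ^{(k),L^kε}(Ω, A) ≤ a_k(L^kε)^{−2}` for `k ≥ 1` ((2.21) and `G^ε_k(Ω, A) ≥ 0`) -/

section Delta

variable (C : ChargeData N) (Ω : Finset (HiggsLattice.Site P 0)) (A : HiggsLattice.VecField P 0)

/-- `a_k ≥ 0` for every `k` (a > 0, L > 1; at `k = 0` the closed form (2.15) is Lean's junk value `0`).
[cite: Balaban1982Higgs1, (2.15) p.609] -/
theorem aSeq_nonneg {a : ℝ} (ha : 0 < a) (hL : 1 < (P.L : ℝ)) : ∀ k : ℕ, 0 ≤ B1.aSeq a P.L k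
  | 0 => by simp [B1.aSeq]
  | k + 1 => (B1.aSeq_pos ha hL (Nat.succ_le_succ (Nat.zero_le k))).le

/-- **`Q_k(A)G^ε_k(Ω, A)Q^*_k(A) ≥ 0`**: `0 ≤ ⟨ψ, Q_k(A)G^ε_k(Ω,A)Q^*_k(A)ψ⟩ = ⟨G^ε_kQ^*_kψ, Q^*_kψ⟩` (adjointness (2.20)
and `G^ε_k ≥ 0`, `HiggsCovariancePos.siteInner_propagatorK_nonneg`; m² > 0). [cite: Balaban1982Higgs1, (2.21) p.610] -/
theorem siteInner_QGQ_nonneg {msq a : ℝ} (hmsq : 0 < msq) (ha : 0 < a) (hL : 1 < (P.L : ℝ)) (k : ℕ)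
    (ψ : ScalarField P k N) :
    0 ≤ siteInner ψ (avgQkLin C A k (propagatorK C Ω A msq a k (avgQkAdj C A k ψ))) := by
  rw [siteInner_comm, siteInner_avgQkLin]
  exact siteInner_propagatorK_nonneg C Ω A hmsq a k (aSeq_nonneg ha hL k) _

/-- **`Δ^{(k),L^kε}(Ω, A) ≤ a_k(L^kε)^{−2}I` for `k ≥ 1`**: `⟨ψ, Δ^{(k)}(Ω,A)ψ⟩ ≤ a_k(L^kε)^{−2}⟨ψ, ψ⟩`, every `A`, `Ω`
(by (2.21): the subtracted term is `≥ 0`). PROVED. [cite: Balaban1982Higgs1, (2.21) p.610] -/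
theorem siteInner_deltaKA_succ_le {msq a : ℝ} (hmsq : 0 < msq) (ha : 0 < a) (hL : 1 < (P.L : ℝ)) (j : ℕ)
    (ψ : ScalarField P (j + 1) N) :
    siteInner ψ (deltaKA C Ω A msq a (j + 1) ψ) ≤ coeff221 P a (j + 1) * siteInner ψ ψ := by
  rw [siteInner_deltaKA_succ]
  have h := mul_nonneg (sq_nonneg (coeff221 P a (j + 1))) (siteInner_QGQ_nonneg C Ω A hmsq ha hL (j + 1) ψ)
  linarith

end Delta

/-! ## §4 The lattice bound `−Δ^{η,N}_{A,Ω} ≤ 4dη^{−2}` and `Δ^{(0)} ≤ 4dε^{−2} + m²` -/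

section Laplacian

variable {k : ℕ} (C : ChargeData N)

/-- `|U(A_b)v| = |v|` (unitarity of the transports, p. 605). [cite: Balaban1982Higgs1, (1.7) p.605] -/
theorem norm_U_apply (η a : ℝ) (v : E N) : ‖C.U η a v‖ = ‖v‖ := by
  have h : ‖C.U η a v‖ ^ 2 = ‖v‖ ^ 2 := by
    rw [← real_inner_self_eq_norm_sq, ← real_inner_self_eq_norm_sq, inner_U_U]
  exact (pow_left_inj₀ (norm_nonneg _) (norm_nonneg _) two_ne_zero).mp h

/-- One bond: `|(D^η_Aφ)(b)|² ≤ 2η^{−2}(|φ(b₊)|² + |φ(b₋)|²)`. [cite: Balaban1982Higgs1, (1.7) p.605] -/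
theorem norm_covDeriv_sq_le (A : HiggsLattice.VecField P k) (φ : ScalarField P k N) (b : HiggsLattice.PBond P k) :
    ‖covDeriv C A φ b‖ ^ 2 ≤ 2 * (P.mesh k)⁻¹ ^ 2 * (‖φ b.tgt‖ ^ 2 + ‖φ b.src‖ ^ 2) := by
  unfold covDeriv
  rw [norm_smul, mul_pow, Real.norm_eq_abs, sq_abs]
  have htri : ‖C.U (P.mesh k) (A b) (φ b.tgt) - φ b.src‖ ≤ ‖φ b.tgt‖ + ‖φ b.src‖ := by
    calc ‖C.U (P.mesh k) (A b) (φ b.tgt) - φ b.src‖ ≤ ‖C.U (P.mesh k) (A b) (φ b.tgt)‖ + ‖φ b.src‖ := norm_sub_le _ _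
      _ = ‖φ b.tgt‖ + ‖φ b.src‖ := by rw [norm_U_apply]
  have hsq : ‖C.U (P.mesh k) (A b) (φ b.tgt) - φ b.src‖ ^ 2 ≤ 2 * (‖φ b.tgt‖ ^ 2 + ‖φ b.src‖ ^ 2) := by
    have h1 : ‖C.U (P.mesh k) (A b) (φ b.tgt) - φ b.src‖ ^ 2 ≤ (‖φ b.tgt‖ + ‖φ b.src‖) ^ 2 :=
      pow_le_pow_left₀ (norm_nonneg _) htri 2
    nlinarith [sq_nonneg (‖φ b.tgt‖ - ‖φ b.src‖)]
  have hpos : 0 ≤ (P.mesh k)⁻¹ ^ 2 := sq_nonneg _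
  calc (P.mesh k)⁻¹ ^ 2 * ‖C.U (P.mesh k) (A b) (φ b.tgt) - φ b.src‖ ^ 2
      ≤ (P.mesh k)⁻¹ ^ 2 * (2 * (‖φ b.tgt‖ ^ 2 + ‖φ b.src‖ ^ 2)) := mul_le_mul_of_nonneg_left hsq hpos
    _ = 2 * (P.mesh k)⁻¹ ^ 2 * (‖φ b.tgt‖ ^ 2 + ‖φ b.src‖ ^ 2) := by ring

/-- `Σ_b η^d|φ(b₋)|² = d⟨φ, φ⟩` (every site is the initial point of `d` positively oriented bonds).
[cite: Balaban1982Higgs1, (1.5) p.604] -/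
theorem sum_bond_src_sq (φ : ScalarField P k N) :
    ∑ b : HiggsLattice.PBond P k, P.mesh k ^ P.d * ‖φ b.src‖ ^ 2 = P.d * siteInner φ φ := by
  have hs : ∑ x : HiggsLattice.Site P k, ∑ _μ : Fin P.d, P.mesh k ^ P.d * ‖φ x‖ ^ 2
      = ∑ b : HiggsLattice.PBond P k, P.mesh k ^ P.d * ‖φ b.src‖ ^ 2 :=
    sum_site_dir (fun x _ => P.mesh k ^ P.d * ‖φ x‖ ^ 2)
  rw [← hs, siteInner_self_eq, Finset.mul_sum]
  refine Finset.sum_congr rfl fun x _ => ?_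
  rw [Finset.sum_const, Finset.card_univ, Fintype.card_fin, nsmul_eq_mul]

/-- `Σ_b η^d|φ(b₊)|² = d⟨φ, φ⟩` (translation by `ηe_μ` is a bijection of `T^{(k)}`). [cite: Balaban1982Higgs1, (1.5) p.604] -/
theorem sum_bond_tgt_sq (φ : ScalarField P k N) :
    ∑ b : HiggsLattice.PBond P k, P.mesh k ^ P.d * ‖φ b.tgt‖ ^ 2 = P.d * siteInner φ φ := by
  have hs : ∑ x : HiggsLattice.Site P k, ∑ μ : Fin P.d, P.mesh k ^ P.d * ‖φ (x.shift μ)‖ ^ 2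
      = ∑ b : HiggsLattice.PBond P k, P.mesh k ^ P.d * ‖φ b.tgt‖ ^ 2 :=
    sum_site_dir (fun x μ => P.mesh k ^ P.d * ‖φ (x.shift μ)‖ ^ 2)
  have hshift : ∀ μ : Fin P.d, ∑ x : HiggsLattice.Site P k, P.mesh k ^ P.d * ‖φ (x.shift μ)‖ ^ 2
      = ∑ x : HiggsLattice.Site P k, P.mesh k ^ P.d * ‖φ x‖ ^ 2 :=
    fun μ => Fintype.sum_equiv (shiftEquiv P k μ) _ _ (fun _ => rfl)
  rw [← hs, Finset.sum_comm, Finset.sum_congr rfl fun μ _ => hshift μ, Finset.sum_const, Finset.card_univ,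
    Fintype.card_fin, nsmul_eq_mul, siteInner_self_eq]

/-- **The lattice bound `−Δ^{η,N}_{A,Ω} ≤ 4dη^{−2}`**: `⟨φ, (−Δ^{η,N}_{A,Ω})φ⟩ ≤ 4dη^{−2}⟨φ, φ⟩` at every level
`η = L^kε`, for EVERY `A`, `Ω`, `C` (the Neumann form keeps only the bonds inside `Ω`, each bounded by
`2η^{−2}(|φ(b₊)|² + |φ(b₋)|²)`). PROVED. [cite: Balaban1982Higgs1, (2.17) p.610] -/
theorem siteInner_covLaplacianN_le (Ω : Finset (HiggsLattice.Site P k)) (A : HiggsLattice.VecField P k)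
    (φ : ScalarField P k N) :
    siteInner φ (covLaplacianN C Ω A φ) ≤ 4 * P.d * (P.mesh k)⁻¹ ^ 2 * siteInner φ φ := by
  rw [siteInner_covLaplacianN]
  have hmesh : 0 ≤ P.mesh k ^ P.d := pow_nonneg (P.mesh_pos k).le _
  have hterm : ∀ b : HiggsLattice.PBond P k,
      (if Inside Ω b then P.mesh k ^ P.d * ⟪covDeriv C A φ b, covDeriv C A φ b⟫_ℝ else 0)
        ≤ P.mesh k ^ P.d * (2 * (P.mesh k)⁻¹ ^ 2 * (‖φ b.tgt‖ ^ 2 + ‖φ b.src‖ ^ 2)) := by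
    intro b
    have hb : P.mesh k ^ P.d * ⟪covDeriv C A φ b, covDeriv C A φ b⟫_ℝ
        ≤ P.mesh k ^ P.d * (2 * (P.mesh k)⁻¹ ^ 2 * (‖φ b.tgt‖ ^ 2 + ‖φ b.src‖ ^ 2)) := by
      rw [real_inner_self_eq_norm_sq]
      exact mul_le_mul_of_nonneg_left (norm_covDeriv_sq_le C A φ b) hmesh
    split_ifs
    · exact hb
    · exact le_trans (mul_nonneg hmesh (real_inner_self_nonneg)) hb
  calc ∑ b : HiggsLattice.PBond P k, (if Inside Ω b then P.mesh k ^ P.d * ⟪covDeriv C A φ b, covDeriv C A φ b⟫_ℝ else 0)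
      ≤ ∑ b : HiggsLattice.PBond P k, P.mesh k ^ P.d * (2 * (P.mesh k)⁻¹ ^ 2 * (‖φ b.tgt‖ ^ 2 + ‖φ b.src‖ ^ 2)) :=
        Finset.sum_le_sum fun b _ => hterm b
    _ = 2 * (P.mesh k)⁻¹ ^ 2 * (∑ b : HiggsLattice.PBond P k, P.mesh k ^ P.d * ‖φ b.tgt‖ ^ 2
          + ∑ b : HiggsLattice.PBond P k, P.mesh k ^ P.d * ‖φ b.src‖ ^ 2) := by
        rw [← Finset.sum_add_distrib, Finset.mul_sum]
        exact Finset.sum_congr rfl fun b _ => by ring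
    _ = 4 * P.d * (P.mesh k)⁻¹ ^ 2 * siteInner φ φ := by
        rw [sum_bond_tgt_sq, sum_bond_src_sq]
        ring

/-- **`Δ^{(0),ε}(Ω, A) = −Δ^{ε,N}_{A,Ω} + m² ≤ (4dε^{−2} + m²)I`** ((2.17)), every `A`, `Ω`, `C`. PROVED.
[cite: Balaban1982Higgs1, (2.17) p.610] -/
theorem siteInner_deltaKA_zero_le (Ω : Finset (HiggsLattice.Site P 0)) (A : HiggsLattice.VecField P 0) (msq a : ℝ)
    (f : ScalarField P 0 N) :
    siteInner f (deltaKA C Ω A msq a 0 f) ≤ (4 * P.d * (P.mesh 0)⁻¹ ^ 2 + msq) * siteInner f f := by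
  simp only [deltaKA_zero, delta0, LinearMap.add_apply, LinearMap.smul_apply, LinearMap.id_apply,
    siteInner_add_right, siteInner_smul_right]
  have h := siteInner_covLaplacianN_le C Ω A f
  linarith

end Laplacian

/-! ## §5 The operator of (2.30)/(2.31): `a(L^{k+1}ε)^{−2}P(A) + Δ^{(k),L^kε}(Ω, A) ≤ γ₁(L^kε)^{−2}I` -/

section Upper

variable (C : ChargeData N) (Ω : Finset (HiggsLattice.Site P 0)) (A : HiggsLattice.VecField P 0)

/-- **(2.33), UPPER inequality, levels `k ≥ 1`** (on the `L^kε`-lattice): for EVERY `A`, `Ω`, `C`, m² > 0, a > 0, L > 1,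
`1 ≤ k < K`:  `⟨f, (a(L^{k+1}ε)^{−2}P(A) + Δ^{(k),L^kε}(Ω,A))f⟩ ≤ (a(L^{k+1}ε)^{−2} + a_k(L^kε)^{−2})⟨f, f⟩`. PROVED.
[cite: Balaban1982Higgs1, (2.33) p.611] -/
theorem siteInner_precOpA_succ_le {msq a : ℝ} (hmsq : 0 < msq) (ha : 0 < a) (hL : 1 < (P.L : ℝ)) {j : ℕ}
    (hj : j + 1 < P.K) (f : ScalarField P (j + 1) N) :
    siteInner f (precOpA C Ω A msq a (j + 1) f)
      ≤ (a * ((P.mesh (j + 1 + 1))⁻¹ ^ 2) + coeff221 P a (j + 1)) * siteInner f f := by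
  rw [precOpA, LinearMap.add_apply, LinearMap.smul_apply, siteInner_add_right, siteInner_smul_right]
  have hP := siteInner_blockProjA_le C A hj f
  have hΔ := siteInner_deltaKA_succ_le C Ω A hmsq ha hL j f
  have hcoef : 0 ≤ a * ((P.mesh (j + 1 + 1))⁻¹ ^ 2) := mul_nonneg ha.le (sq_nonneg _)
  nlinarith [mul_le_mul_of_nonneg_left hP hcoef]

/-- `(L^{k+1}ε)^{−2} = L^{−2}(L^kε)^{−2}`. [cite: Balaban1982Higgs1, (1.19) p.607] -/
theorem mesh_succ_inv_sq (j : ℕ) : ((P.mesh (j + 1))⁻¹ ^ 2) = ((P.L : ℝ) ^ 2)⁻¹ * ((P.mesh j)⁻¹ ^ 2) := by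
  have hmesh : P.mesh (j + 1) = P.L * P.mesh j := by
    unfold HiggsLattice.Params.mesh; rw [pow_succ]; ring
  rw [hmesh, mul_inv, mul_pow, inv_pow]

/-- **(2.33)-upper, UNIFORM form on the `L^kε`-lattice**: `⟨f, (a(L^{k+1}ε)^{−2}P(A) + Δ^{(k),L^kε}(Ω,A))f⟩ ≤
(aL^{−2} + a)(L^kε)^{−2}⟨f, f⟩` for all `1 ≤ k < K`, every `A`, `Ω`, `C`, `ε` (`a_k ≤ a`, `B1.aSeq_le`). PROVED.
[cite: Balaban1982Higgs1, (2.33) p.611] -/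
theorem siteInner_precOpA_succ_le_uniform {msq a : ℝ} (hmsq : 0 < msq) (ha : 0 < a) (hL : 1 < (P.L : ℝ)) {j : ℕ}
    (hj : j + 1 < P.K) (f : ScalarField P (j + 1) N) :
    siteInner f (precOpA C Ω A msq a (j + 1) f)
      ≤ (a * ((P.L : ℝ) ^ 2)⁻¹ + a) * ((P.mesh (j + 1))⁻¹ ^ 2) * siteInner f f := by
  have h := siteInner_precOpA_succ_le C Ω A hmsq ha hL hj f
  have hak : B1.aSeq a P.L (j + 1) ≤ a := B1.aSeq_le ha hL (j + 1) (Nat.succ_le_succ (Nat.zero_le j))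
  have hm : 0 ≤ (P.mesh (j + 1))⁻¹ ^ 2 := sq_nonneg _
  have hff := siteInner_self_nonneg f
  have hcoef : a * ((P.mesh (j + 1 + 1))⁻¹ ^ 2) + coeff221 P a (j + 1)
      ≤ (a * ((P.L : ℝ) ^ 2)⁻¹ + a) * ((P.mesh (j + 1))⁻¹ ^ 2) := by
    rw [coeff221_eq, mesh_succ_inv_sq (j + 1), ← mul_assoc, add_mul]
    exact add_le_add le_rfl (mul_le_mul_of_nonneg_right hak hm)
  exact h.trans (mul_le_mul_of_nonneg_right hcoef hff)

/-- **(2.33), UPPER inequality, level `k = 0`** (on `T_ε`): `⟨f, (a(Lε)^{−2}P(A) − Δ^{ε,N}_{A,Ω} + m²)f⟩ ≤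
(a(Lε)^{−2} + 4dε^{−2} + m²)⟨f, f⟩`, every `A`, `Ω`, `C`, a ≥ 0, `0 < K`. PROVED. [cite: Balaban1982Higgs1, (2.33) p.611] -/
theorem siteInner_precOpA_zero_le {a : ℝ} (ha : 0 ≤ a) (hK : 0 < P.K) (msq : ℝ) (f : ScalarField P 0 N) :
    siteInner f (precOpA C Ω A msq a 0 f)
      ≤ (a * ((P.mesh (0 + 1))⁻¹ ^ 2) + (4 * P.d * (P.mesh 0)⁻¹ ^ 2 + msq)) * siteInner f f := by
  rw [precOpA, LinearMap.add_apply, LinearMap.smul_apply, siteInner_add_right, siteInner_smul_right]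
  have hP := siteInner_blockProjA_le C A hK f
  have hΔ := siteInner_deltaKA_zero_le C Ω A msq a f
  have hcoef : 0 ≤ a * ((P.mesh (0 + 1))⁻¹ ^ 2) := mul_nonneg ha (sq_nonneg _)
  nlinarith [mul_le_mul_of_nonneg_left hP hcoef]

/-- **(2.33)-upper IN THE PRINT'S LETTERS**, on the unit lattice of (2.31) (`P.unitAt k`: spacing `L^{−k}` at level 0,
`1` at level `k`, where the operator of (2.30) reads `aL^{−2}P(A) + Δ^{(k)}(Ω, A)`, `B1Eq230FluctCovPos.precOpA_unitAt`):
`⟨f, (aL^{−2}P(A) + Δ^{(k)}(Ω,A))f⟩ ≤ (aL^{−2} + a_k)⟨f, f⟩`, every `A`, `Ω`, `C`, `1 ≤ k < K`, m² > 0. PROVED.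
[cite: Balaban1982Higgs1, (2.33) p.611] -/
theorem ineq233_upper_unitAt {msq a : ℝ} (hmsq : 0 < msq) (ha : 0 < a) (hL : 1 < (P.L : ℝ)) {k : ℕ} (hk1 : 1 ≤ k)
    (hkK : k < P.K) (C : ChargeData N) (Ω : Finset (HiggsLattice.Site (P.unitAt k) 0))
    (A : HiggsLattice.VecField (P.unitAt k) 0) (f : ScalarField (P.unitAt k) k N) :
    siteInner f (precOpA C Ω A msq a k f) ≤ (a * ((P.L : ℝ) ^ 2)⁻¹ + B1.aSeq a P.L k) * siteInner f f := by
  obtain ⟨j, rfl⟩ : ∃ j, k = j + 1 := ⟨k - 1, by omega⟩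
  have h := siteInner_precOpA_succ_le (P := P.unitAt (j + 1)) C Ω A hmsq ha hL hkK f
  rw [stepCoeff_unitAt, coeff221_unitAt] at h
  exact h

/-- **(2.33)-upper with ONE CONSTANT `γ₁ = a(1 + L^{−2})`** — *"dependent on d and a, and independent of A, k, Ω and
Λ"* (here: on `a` and the block size `L` only): on the unit lattice, `⟨f, (aL^{−2}P(A) + Δ^{(k)}(Ω,A))f⟩ ≤
a(1 + L^{−2})⟨f, f⟩` for ALL `1 ≤ k < K`, ALL `A`, `Ω`, `C`, `ε` (m² > 0). PROVED. [cite: Balaban1982Higgs1, (2.33) p.611] -/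
theorem ineq233_upper_uniform {msq a : ℝ} (hmsq : 0 < msq) (ha : 0 < a) (hL : 1 < (P.L : ℝ)) {k : ℕ} (hk1 : 1 ≤ k)
    (hkK : k < P.K) (C : ChargeData N) (Ω : Finset (HiggsLattice.Site (P.unitAt k) 0))
    (A : HiggsLattice.VecField (P.unitAt k) 0) (f : ScalarField (P.unitAt k) k N) :
    siteInner f (precOpA C Ω A msq a k f) ≤ a * (1 + ((P.L : ℝ) ^ 2)⁻¹) * siteInner f f := by
  have h := ineq233_upper_unitAt hmsq ha hL hk1 hkK C Ω A f
  have hak : B1.aSeq a P.L k ≤ a := B1.aSeq_le ha hL k hk1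
  have hff := siteInner_self_nonneg f
  have hcoef : a * ((P.L : ℝ) ^ 2)⁻¹ + B1.aSeq a P.L k ≤ a * (1 + ((P.L : ℝ) ^ 2)⁻¹) := by linarith
  exact h.trans (mul_le_mul_of_nonneg_right hcoef hff)

/-- The uniform constant is at most `2a` (`L ≥ 1`). [cite: Balaban1982Higgs1, (2.33) p.611] -/
theorem gamma1_le_two_mul {a : ℝ} (ha : 0 ≤ a) (hL : 1 ≤ (P.L : ℝ)) : a * (1 + ((P.L : ℝ) ^ 2)⁻¹) ≤ 2 * a := by
  have h1 : ((P.L : ℝ) ^ 2)⁻¹ ≤ 1 := inv_le_one_of_one_le₀ (one_le_pow₀ hL)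
  nlinarith

end Upper

/-! ## §6 The covariances: `C^{(k)}(Ω, A) ≥ γ₁^{−1}I` ((2.30)/(2.31)) and `C^{(k)}_Λ(Ω, A) ≥ γ₁^{−1}I↾_Λ` ((2.32)) -/

section Covariance

variable (C : ChargeData N) (Ω : Finset (HiggsLattice.Site P 0)) (A : HiggsLattice.VecField P 0)

/-- `⟨f, (a(L^{k+1}ε)^{−2}P(A) + Δ^{(k)}(Ω,A))f⟩ ≥ 0` (m² > 0, a > 0, L > 1, `k ≤ K`; the typer's positivity).
[cite: Balaban1982Higgs1, (2.30) p.611] -/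
theorem siteInner_precOpA_nonneg {msq a : ℝ} (hmsq : 0 < msq) (ha : 0 < a) (hL : 1 < (P.L : ℝ)) {k : ℕ}
    (hk : k ≤ P.K) (f : ScalarField P k N) : 0 ≤ siteInner f (precOpA C Ω A msq a k f) := by
  by_cases hf : f = 0
  · rw [hf, map_zero, HiggsFluctMeasureCov.siteInner_zero_right]
  · exact (siteInner_precOpA_pos C Ω A hmsq ha hL hk hf).le

/-- **`C^{(k),L^kε}(Ω, A) ≥ (a(L^{k+1}ε)^{−2} + a_k(L^kε)^{−2})^{−1}I`, `1 ≤ k < K`** — the covariance (2.30) is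
bounded BELOW uniformly, for EVERY `A`, `Ω`, `C` (m² > 0): the dual of the upper inequality of (2.33). PROVED.
[cite: Balaban1982Higgs1, (2.30) p.611] -/
theorem siteInner_fluctCovA_ge_succ {msq a : ℝ} (hmsq : 0 < msq) (ha : 0 < a) (hL : 1 < (P.L : ℝ)) {j : ℕ}
    (hj : j + 1 < P.K) (g : ScalarField P (j + 1) N) :
    (a * ((P.mesh (j + 1 + 1))⁻¹ ^ 2) + coeff221 P a (j + 1))⁻¹ * siteInner g g
      ≤ siteInner g (fluctCovA C Ω A msq a (j + 1) g) := by
  have hβ : 0 < a * ((P.mesh (j + 1 + 1))⁻¹ ^ 2) + coeff221 P a (j + 1) :=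
    add_pos_of_nonneg_of_pos (mul_nonneg ha.le (sq_nonneg _))
      (coeff221_pos ha hL (Nat.succ_le_succ (Nat.zero_le j)))
  exact siteInner_inv_ge_of_form_le _ _ (siteInner_precOpA_comm C Ω A msq a (j + 1))
    (siteInner_precOpA_nonneg C Ω A hmsq ha hL hj.le) hβ (siteInner_precOpA_succ_le C Ω A hmsq ha hL hj) g
    (precOpA_fluctCovA_apply C Ω A (isUnit_precOpA_of_le C Ω A hmsq ha hL hj.le) g)

/-- **`C^{(0),ε}(Ω, A) ≥ (a(Lε)^{−2} + 4dε^{−2} + m²)^{−1}I`** (level `0`, `0 < K`), every `A`, `Ω`, `C` (m² > 0). PROVED.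
[cite: Balaban1982Higgs1, (2.30) p.611] -/
theorem siteInner_fluctCovA_ge_zero {msq a : ℝ} (hmsq : 0 < msq) (ha : 0 < a) (hL : 1 < (P.L : ℝ)) (hK : 0 < P.K)
    (g : ScalarField P 0 N) :
    (a * ((P.mesh (0 + 1))⁻¹ ^ 2) + (4 * P.d * (P.mesh 0)⁻¹ ^ 2 + msq))⁻¹ * siteInner g g
      ≤ siteInner g (fluctCovA C Ω A msq a 0 g) := by
  have hβ : 0 < a * ((P.mesh (0 + 1))⁻¹ ^ 2) + (4 * P.d * (P.mesh 0)⁻¹ ^ 2 + msq) :=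
    add_pos_of_nonneg_of_pos (mul_nonneg ha.le (sq_nonneg _))
      (add_pos_of_nonneg_of_pos (mul_nonneg (mul_nonneg (by norm_num) (Nat.cast_nonneg _)) (sq_nonneg _)) hmsq)
  exact siteInner_inv_ge_of_form_le _ _ (siteInner_precOpA_comm C Ω A msq a 0)
    (siteInner_precOpA_nonneg C Ω A hmsq ha hL (Nat.zero_le _)) hβ
    (siteInner_precOpA_zero_le C Ω A ha.le hK msq) g
    (precOpA_fluctCovA_apply C Ω A (isUnit_precOpA_of_le C Ω A hmsq ha hL (Nat.zero_le _)) g)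

/-- **`C^{(k)}(Ω, A) ≥ γ₁^{−1}I` with the uniform `γ₁ = a(1 + L^{−2})`**, on the unit lattice of (2.31): `⟨g, C^{(k)}(Ω,A)g⟩
≥ (a(1 + L^{−2}))^{−1}⟨g, g⟩` for ALL `1 ≤ k < K`, `A`, `Ω`, `C`, `ε` (m² > 0). PROVED. [cite: Balaban1982Higgs1, (2.31) p.611] -/
theorem fluctCovA_ge_uniform_unitAt {msq a : ℝ} (hmsq : 0 < msq) (ha : 0 < a) (hL : 1 < (P.L : ℝ)) {k : ℕ}
    (hk1 : 1 ≤ k) (hkK : k < P.K) (C : ChargeData N) (Ω : Finset (HiggsLattice.Site (P.unitAt k) 0))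
    (A : HiggsLattice.VecField (P.unitAt k) 0) (g : ScalarField (P.unitAt k) k N) :
    (a * (1 + ((P.L : ℝ) ^ 2)⁻¹))⁻¹ * siteInner g g ≤ siteInner g (fluctCovA C Ω A msq a k g) := by
  have hβ : 0 < a * (1 + ((P.L : ℝ) ^ 2)⁻¹) := mul_pos ha (add_pos_of_pos_of_nonneg one_pos (inv_nonneg.mpr (sq_nonneg _)))
  exact siteInner_inv_ge_of_form_le _ _ (siteInner_precOpA_comm C Ω A msq a k)
    (siteInner_precOpA_nonneg C Ω A hmsq ha hL hkK.le) hβ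
    (ineq233_upper_uniform hmsq ha hL hk1 hkK C Ω A) g
    (precOpA_fluctCovA_apply C Ω A (isUnit_precOpA_of_le C Ω A hmsq ha hL hkK.le) g)

/-! ### The conditioned covariances (2.32) -/

/-- `|Λf|² ≤ |f|²` for the cut `Λ` (p. 611, `A↾_Λ = ΛAΛ`). [cite: Balaban1982Higgs1, (2.32) p.611] -/
theorem siteInner_cutTo_self_le {k : ℕ} (Λ : Finset (HiggsLattice.Site P k)) (f : ScalarField P k N) :
    siteInner (cutTo Λ f) (cutTo Λ f) ≤ siteInner f f := by
  rw [siteInner_self_eq, siteInner_self_eq]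
  refine Finset.sum_le_sum fun x _ => mul_le_mul_of_nonneg_left ?_ (pow_nonneg (P.mesh_pos k).le _)
  by_cases hx : x ∈ Λ
  · rw [cutTo_of_mem Λ f hx]
  · rw [cutTo_of_not_mem Λ f hx, norm_zero, zero_pow two_ne_zero]
    exact sq_nonneg _

/-- **The restriction of (2.32) inherits the upper bound**: if `⟨f, Mf⟩ ≤ β⟨f, f⟩` for all `f` (`β ≥ 0`) then
`⟨f, (M↾_Λ)f⟩ = ⟨Λf, MΛf⟩ ≤ β⟨f, f⟩`. [cite: Balaban1982Higgs1, (2.32) p.611] -/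
theorem siteInner_restrictOp_le {k : ℕ} (Λ : Finset (HiggsLattice.Site P k)) {M : Module.End ℝ (ScalarField P k N)}
    {β : ℝ} (hβ : 0 ≤ β) (hle : ∀ f : ScalarField P k N, siteInner f (M f) ≤ β * siteInner f f)
    (f : ScalarField P k N) : siteInner f (restrictOp Λ M f) ≤ β * siteInner f f := by
  rw [siteInner_restrictOp]
  exact (hle (cutTo Λ f)).trans (mul_le_mul_of_nonneg_left (siteInner_cutTo_self_le Λ f) hβ)

/-- **(2.33)-upper for the RESTRICTED operator of (2.32)**, on the unit lattice: `⟨f, ((aL^{−2}P(A) + Δ^{(k)}(Ω,A))↾_Λ)f⟩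
≤ a(1 + L^{−2})⟨f, f⟩` for ALL `Λ ⊂ T^{(k)}`, `1 ≤ k < K`, `A`, `Ω`, `C`, `ε` — *"independent of … Λ"*. PROVED.
[cite: Balaban1982Higgs1, (2.33) p.611] -/
theorem siteInner_restrictOp_precOpA_le {msq a : ℝ} (hmsq : 0 < msq) (ha : 0 < a) (hL : 1 < (P.L : ℝ)) {k : ℕ}
    (hk1 : 1 ≤ k) (hkK : k < P.K) (C : ChargeData N) (Ω : Finset (HiggsLattice.Site (P.unitAt k) 0))
    (A : HiggsLattice.VecField (P.unitAt k) 0) (Λ : Finset (HiggsLattice.Site (P.unitAt k) k))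
    (f : ScalarField (P.unitAt k) k N) :
    siteInner f (restrictOp Λ (precOpA C Ω A msq a k) f) ≤ a * (1 + ((P.L : ℝ) ^ 2)⁻¹) * siteInner f f :=
  siteInner_restrictOp_le Λ (mul_nonneg ha.le (add_nonneg zero_le_one (inv_nonneg.mpr (sq_nonneg _))))
    (ineq233_upper_uniform hmsq ha hL hk1 hkK C Ω A) f

/-- **`C^{(k)}_Λ(Ω, A) ≥ γ₁^{−1}I↾_Λ`, `γ₁ = a(1 + L^{−2})`** — the conditional covariance (2.32) of the concrete model
(`HiggsCondCov232.condCov232`) is bounded below on the configurations on `Λ`: `⟨g, C^{(k)}_Λ(Ω,A)g⟩ ≥ γ₁^{−1}⟨g, g⟩` for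
every `g` supported in `Λ` (`Λg = g`), ALL `Λ`, `1 ≤ k < K`, `A`, `Ω`, `C`, `ε` (m² > 0; unit lattice of (2.31)). PROVED.
[cite: Balaban1982Higgs1, (2.32) p.611] -/
theorem siteInner_condCov232_ge {msq a : ℝ} (hmsq : 0 < msq) (ha : 0 < a) (hL : 1 < (P.L : ℝ)) {k : ℕ}
    (hk1 : 1 ≤ k) (hkK : k < P.K) (C : ChargeData N) (Ω : Finset (HiggsLattice.Site (P.unitAt k) 0))
    (A : HiggsLattice.VecField (P.unitAt k) 0) (Λ : Finset (HiggsLattice.Site (P.unitAt k) k))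
    {g : ScalarField (P.unitAt k) k N} (hg : cutTo Λ g = g) :
    (a * (1 + ((P.L : ℝ) ^ 2)⁻¹))⁻¹ * siteInner g g ≤ siteInner g (condCov232 C Ω A msq a k Λ g) := by
  have hβ : 0 < a * (1 + ((P.L : ℝ) ^ 2)⁻¹) := mul_pos ha (add_pos_of_pos_of_nonneg one_pos (inv_nonneg.mpr (sq_nonneg _)))
  have hinv : restrictOp Λ (precOpA C Ω A msq a k) (condCov232 C Ω A msq a k Λ g) = g := by
    rw [restrictOp_precOpA_condCov232_apply C Ω A hmsq ha hL hkK.le Λ g, hg]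
  refine siteInner_inv_ge_of_form_le _ _
    (siteInner_restrictOp_comm (siteInner_precOpA_comm C Ω A msq a k) Λ) (fun f => ?_) hβ
    (siteInner_restrictOp_precOpA_le hmsq ha hL hk1 hkK C Ω A Λ) g hinv
  rw [siteInner_restrictOp]
  exact siteInner_precOpA_nonneg C Ω A hmsq ha hL hkK.le _

/-- The same for an arbitrary `g`: `⟨g, C^{(k)}_Λ(Ω,A)g⟩ ≥ γ₁^{−1}⟨Λg, Λg⟩` (`C^{(k)}_Λ` reads only `Λg` and vanishes
off `Λ`). [cite: Balaban1982Higgs1, (2.32) p.611] -/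
theorem siteInner_condCov232_ge' {msq a : ℝ} (hmsq : 0 < msq) (ha : 0 < a) (hL : 1 < (P.L : ℝ)) {k : ℕ}
    (hk1 : 1 ≤ k) (hkK : k < P.K) (C : ChargeData N) (Ω : Finset (HiggsLattice.Site (P.unitAt k) 0))
    (A : HiggsLattice.VecField (P.unitAt k) 0) (Λ : Finset (HiggsLattice.Site (P.unitAt k) k))
    (g : ScalarField (P.unitAt k) k N) :
    (a * (1 + ((P.L : ℝ) ^ 2)⁻¹))⁻¹ * siteInner (cutTo Λ g) (cutTo Λ g)
      ≤ siteInner g (condCov232 C Ω A msq a k Λ g) := by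
  have h := siteInner_condCov232_ge hmsq ha hL hk1 hkK C Ω A Λ (cutTo_cutTo Λ g)
  rw [condCov232_cutTo] at h
  have hread : siteInner (cutTo Λ g) (condCov232 C Ω A msq a k Λ g) = siteInner g (condCov232 C Ω A msq a k Λ g) := by
    rw [condCov232, restrictInv_apply]
    exact (siteInner_cutTo Λ g _).symm
  rw [hread] at h
  exact h

end Covariance

end Literature.MathematicalPhysics.QuantumFieldTheory.Balaban1983to89.B1Ineq233Upper
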